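import Literature.MathematicalPhysics.QuantumLattice.HubbardTTPrimeThermalPressureZeemanTorus
import HarnessLib

/-!
# The canonical pressure in a Zeeman field IS the thermodynamic limit of the fixed-filling torus partition
# function in the field: `L⁻² log Z_{rectN n L}^h(L) → pressureTT'Zeeman β t t' U n h`, with the certificate dictionary

Topic `MathematicalPhysics/QuantumLattice` (family `hubbard`; stage S2 (iii) `T > 0`, the `T × H` axes of the
phase map). Sequel of `HubbardTTPrimeThermalPressureZeeman` (the number) and `…ZeemanTorus` (the finite-volume
sector sum `torusPartitionSumTT'Zeeman`, its pressure `torusPressureTT'Zeeman`, and the UPPER half of the limit).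

* §1 **LOWER HALF** (`β > 0`, `U ≥ 0`, `0 < n < 2`): eventually `pressureTT'Zeeman … − ε ≤ torusPressureTT'Zeeman … L`
  — one `ε/4`-dominant sector `(x, n−x)` of the fibre (`exists_dominant`), realised by the sector numbers
  `(⌊xL²⌋, ⌊(n−x)L²⌋)` rounded onto the total `rectN n L` (moves of `≤ 1` up and `≤ 2` down electrons, priced by the
  equicontinuity moduli `β(4|t|+4|t'|+U)` per electron, `abs_interactionEntropy_sub_le_fst/snd`, and by
  `|Δ log C(L², ·)| ≤ |Δ|·log L² ≤ 2|Δ| L` of binomial entropy), plus the convergence of the dominant sector's own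
  pressure (`tendsto_spinSectorPressureTT'`);
* §2 **THE LIMIT** `tendsto_torusPressureTT'Zeeman` (both halves) and along every side sequence `Ls → ∞`;
* §3 THE DICTIONARY: eventual per-volume ceilings / floors on `log torusPartitionSumTT'Zeeman` along any `Ls → ∞`
  are bounds on the number (`pressureTT'Zeeman_le_of_eventually`, `le_pressureTT'Zeeman_of_eventually`), and ONE
  certified spin sector of filling `n` is a floor (`le_pressureTT'Zeeman_of_eventually_sector`) — the shapes a
  `T > 0` certificate in a field deposits.

HONEST SCOPE: existence/identification of a thermodynamic-limit NUMBER; no certificate value; no phase word; no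
state class; no definition. Everything PROVED, 0 sorry.

## Mathlib / tree search
REUSED: `exists_dominant`, `tendsto_spinSectorPressureTT'`, `halfRectN_lt_sq`, `rectN_le`, `lt_rectN_add_two`,
`abs_interactionEntropy_sub_le_fst/snd`, `term_le_torusPartitionSumTT'Zeeman`, `torusPartitionSumTT'Zeeman_pos`,
`eventually_torusPressureTT'Zeeman_le`; Mathlib `Nat.choose_succ_right_eq`, `Nat.floor_le`, `Nat.lt_floor_add_one`,
`tendsto_order`, `le_of_tendsto`, `ge_of_tendsto`.

## References
* D. Ruelle, *Statistical Mechanics: Rigorous Results* (1969), §3.4. [cite: Ruelle1969, §3.4]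
* R. B. Israel, *Convexity in the Theory of Lattice Gases* (1979), Thm. I.2.4. [cite: Israel1979, Thm. I.2.4]
-/

noncomputable section

namespace Literature.MathematicalPhysics.QuantumLattice

namespace ThermodynamicLimit

open _root_.Filter Set Finset Matrix
open scoped _root_.Topology BigOperators

/-! ### §0 Arithmetic tools: binomial steps, floors, rounding -/

/-- `|log C(M, k+1) − log C(M, k)| ≤ log M` for `k + 1 ≤ M` (`C(M,k+1)(k+1) = C(M,k)(M−k)`). [folklore] -/
private theorem abs_log_choose_succ_sub_le {M k : ℕ} (hk : k + 1 ≤ M) :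
    |Real.log (M.choose (k + 1)) - Real.log (M.choose k)| ≤ Real.log M := by
  have hkM : k ≤ M := by omega
  have h := Nat.choose_succ_right_eq M k
  have hR : ((M.choose (k + 1) : ℕ) : ℝ) * ((k : ℝ) + 1) = ((M.choose k : ℕ) : ℝ) * ((M : ℝ) - k) := by
    rw [← Nat.cast_sub hkM]; exact_mod_cast h
  have hc1 : (0 : ℝ) < ((M.choose (k + 1) : ℕ) : ℝ) := by exact_mod_cast Nat.choose_pos hk
  have hc0 : (0 : ℝ) < ((M.choose k : ℕ) : ℝ) := by exact_mod_cast Nat.choose_pos hkM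
  have hk1 : (1 : ℝ) ≤ (k : ℝ) + 1 := by linarith [(Nat.cast_nonneg k : (0 : ℝ) ≤ k)]
  have hM1 : (1 : ℝ) ≤ (M : ℝ) := by exact_mod_cast (show 1 ≤ M by omega)
  have hMk : (1 : ℝ) ≤ (M : ℝ) - k := by
    have : ((k : ℝ) + 1) ≤ (M : ℝ) := by exact_mod_cast hk
    linarith
  have hlog := congrArg Real.log hR
  rw [Real.log_mul hc1.ne' (by linarith), Real.log_mul hc0.ne' (by linarith)] at hlog
  have e : Real.log (M.choose (k + 1)) - Real.log (M.choose k) = Real.log ((M : ℝ) - k) - Real.log ((k : ℝ) + 1) := by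
    linarith
  rw [e, abs_le]
  have l1 : 0 ≤ Real.log ((k : ℝ) + 1) := Real.log_nonneg hk1
  have l2 : Real.log ((k : ℝ) + 1) ≤ Real.log M := Real.log_le_log (by linarith) (by exact_mod_cast hk)
  have l3 : 0 ≤ Real.log ((M : ℝ) - k) := Real.log_nonneg hMk
  have l4 : Real.log ((M : ℝ) - k) ≤ Real.log M := Real.log_le_log (by linarith) (by linarith [show (0:ℝ) ≤ k by positivity])
  constructor <;> linarith

/-- `|log C(M, k') − log C(M, k)| ≤ (k' − k) log M` for `k ≤ k' ≤ M`. [folklore] -/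
private theorem abs_log_choose_sub_le {M k d : ℕ} (hk : k + d ≤ M) :
    |Real.log (M.choose (k + d)) - Real.log (M.choose k)| ≤ d * Real.log M := by
  induction d with
  | zero => simp
  | succ d ih =>
    have h1 := ih (by omega)
    have h2 := abs_log_choose_succ_sub_le (M := M) (k := k + d) (by omega)
    rw [show k + (d + 1) = k + d + 1 by ring]
    calc |Real.log (M.choose (k + d + 1)) - Real.log (M.choose k)|
        = |(Real.log (M.choose (k + d + 1)) - Real.log (M.choose (k + d))) +
            (Real.log (M.choose (k + d)) - Real.log (M.choose k))| := by ring_nf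
      _ ≤ |Real.log (M.choose (k + d + 1)) - Real.log (M.choose (k + d))| +
            |Real.log (M.choose (k + d)) - Real.log (M.choose k)| := abs_add_le _ _
      _ ≤ Real.log M + d * Real.log M := add_le_add h2 h1
      _ = ((d + 1 : ℕ) : ℝ) * Real.log M := by push_cast; ring

/-- Floor bounds for the spin-sector numbers: `⌊cL²⌋ ≤ cL² < ⌊cL²⌋ + 1` (`halfRectN (2c) L = ⌊cL²⌋`). [folklore] -/
private theorem halfRectN_two_mul_bounds {c : ℝ} (hc : 0 ≤ c) (L : ℕ) :
    (halfRectN (2 * c) L : ℝ) ≤ c * (L : ℝ) ^ 2 ∧ c * (L : ℝ) ^ 2 < halfRectN (2 * c) L + 1 := by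
  have e : 2 * c * (L : ℝ) ^ 2 / 2 = c * (L : ℝ) ^ 2 := by ring
  unfold halfRectN
  rw [e]
  exact ⟨Nat.floor_le (by positivity), Nat.lt_floor_add_one _⟩

/-- Rounding a pair of sector numbers onto a prescribed even total moves them by at most `1` and `2`. [folklore] -/
private theorem rounding_aux {a₀ b₀ N : ℕ} {X Y : ℝ} (ha : (a₀ : ℝ) ≤ X) (ha' : X < a₀ + 1)
    (hb : (b₀ : ℝ) ≤ Y) (hb' : Y < b₀ + 1) (hN : (N : ℝ) ≤ X + Y) (hN' : X + Y < N + 2) :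
    |((min a₀ N : ℕ) : ℝ) - a₀| ≤ 1 ∧ |((N - min a₀ N : ℕ) : ℝ) - b₀| ≤ 2 := by
  rcases le_total a₀ N with h | h
  · rw [min_eq_left h, Nat.cast_sub h]
    refine ⟨by simp, ?_⟩
    rw [abs_le]; constructor <;> linarith
  · rw [min_eq_right h, Nat.sub_self]
    have h1 : a₀ ≤ N + 1 := by
      have : (a₀ : ℝ) < N + 2 := by linarith [show (0 : ℝ) ≤ b₀ by positivity]
      exact Nat.lt_succ_iff.1 (by exact_mod_cast this)
    have h2 : (N : ℝ) ≤ a₀ := by exact_mod_cast h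
    have h3 : (a₀ : ℝ) ≤ N + 1 := by exact_mod_cast h1
    refine ⟨by rw [abs_le]; constructor <;> linarith, ?_⟩
    have hb0 : (b₀ : ℝ) < 2 := by linarith
    rw [abs_le]; push_cast; constructor <;> linarith [show (0 : ℝ) ≤ b₀ by positivity]

/-- Symmetric form of the binomial step bound: `|log C(M,a) − log C(M,a')| ≤ |a − a'|·log M` (`a, a' ≤ M`). [folklore] -/
private theorem abs_log_choose_sub_le' {M a a' : ℕ} (ha : a ≤ M) (ha' : a' ≤ M) :
    |Real.log (M.choose a) - Real.log (M.choose a')| ≤ |(a : ℝ) - a'| * Real.log M := by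
  rcases le_total a' a with h | h
  · obtain ⟨d, rfl⟩ : ∃ d, a = a' + d := ⟨a - a', by omega⟩
    have := abs_log_choose_sub_le (M := M) (k := a') (d := d) ha
    rwa [show ((a' + d : ℕ) : ℝ) - a' = d by push_cast; ring, Nat.abs_cast]
  · obtain ⟨d, rfl⟩ : ∃ d, a' = a + d := ⟨a' - a, by omega⟩
    have := abs_log_choose_sub_le (M := M) (k := a) (d := d) ha'
    rw [abs_sub_comm] at this
    rwa [show (a : ℝ) - ((a + d : ℕ) : ℝ) = -d by push_cast; ring, abs_neg, Nat.abs_cast]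

/-- `log (L·L) ≤ 2L`. [folklore] -/
private theorem log_mul_self_le (L : ℕ) : Real.log ((L * L : ℕ) : ℝ) ≤ 2 * L := by
  rcases Nat.eq_zero_or_pos L with rfl | hL
  · simp
  · have hLr : (0 : ℝ) < L := by exact_mod_cast hL
    have h1 := Real.log_le_sub_one_of_pos hLr
    push_cast
    rw [Real.log_mul hLr.ne' hLr.ne']
    linarith

/-! ### §1 The lower half of the thermodynamic limit -/

section Limit

variable {β : ℝ} (hβ : 0 < β) (t t' : ℝ) {U : ℝ} (hU : 0 ≤ U) {n : ℝ} (hn0 : 0 < n) (hn2 : n < 2) (hz : ℝ)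
include hβ hU hn0 hn2
set_option maxHeartbeats 400000 in
/-- **LOWER HALF** (`β > 0`, `U ≥ 0`, `0 < n < 2`): eventually `p(n,h) − ε ≤ p_L(n,h)`: one `ε/4`-dominant sector
`(x, n−x)` of the fibre, realised by the sector numbers `(⌊xL²⌋, ⌊(n−x)L²⌋)` rounded onto the total `rectN n L`
(moves of `≤ 1`, `≤ 2` electrons, priced by the equicontinuity moduli `β(4|t|+4|t'|+U)` per electron and
`log L²` per electron of binomial entropy). [cite: Ruelle1969, §3.4] -/
theorem eventually_le_torusPressureTT'Zeeman {ε : ℝ} (hε : 0 < ε) :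
    ∀ᶠ L : ℕ in atTop, pressureTT'Zeeman β t t' U n hz - ε ≤ torusPressureTT'Zeeman β t t' U n hz L := by
  obtain ⟨x, hx, hdom⟩ := exists_dominant t t' hn0.le hn2 (β := β) (U := U) hz (ε := ε / 4) (by positivity)
  obtain ⟨hx0, hx1, hy0, hy1⟩ := hx
  set y := n - x with hy
  set κ : ℝ := β * (4 * |t| + 4 * |t'| + U) with hκ
  have hκ0 : 0 ≤ κ := by rw [hκ]; have := hβ.le; positivity
  -- (E1) the dominant sector's own pressure converges
  have hconv := tendsto_spinSectorPressureTT' hβ.le t t' hU hx0 hx1 hy0 hy1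
  have hE1 : ∀ᶠ L : ℕ in atTop, pressureTT'₂ β t t' U x y - ε / 4 ≤ spinSectorPressureTT' β t t' U x y L :=
    (hconv.eventually (Ioi_mem_nhds (by linarith : pressureTT'₂ β t t' U x y - ε / 4 < pressureTT'₂ β t t' U x y))).mono
      fun L h => h.le
  -- (E2) volume thresholds
  have hE2 : ∀ᶠ L : ℕ in atTop, 5 * |β * hz| ≤ ε / 4 * (L : ℝ) ^ 2 ∧ (3 * κ + 6) * L ≤ ε / 4 * (L : ℝ) ^ 2 ∧
      2 ≤ (1 - y) * (L : ℝ) ^ 2 := by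
    have hy1' : 0 < 1 - y := by linarith
    filter_upwards [tendsto_natCast_atTop_atTop.eventually_ge_atTop
      (max (5 * |β * hz| / (ε / 4) + 1) (max ((3 * κ + 6) / (ε / 4)) (2 / (1 - y) + 1)))] with L hL
    have hε4 : (0 : ℝ) < ε / 4 := by positivity
    have hL0 : (1 : ℝ) ≤ L := by
      have : (0 : ℝ) ≤ 5 * |β * hz| / (ε / 4) := by positivity
      linarith [le_max_left (5 * |β * hz| / (ε / 4) + 1) (max ((3 * κ + 6) / (ε / 4)) (2 / (1 - y) + 1))]
    have hLsq : (L : ℝ) ≤ (L : ℝ) ^ 2 := by nlinarith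
    have hmul : (1 - y) * (L : ℝ) ≤ (1 - y) * (L : ℝ) ^ 2 := mul_le_mul_of_nonneg_left hLsq hy1'.le
    refine ⟨?_, ?_, ?_⟩
    · have h1 : 5 * |β * hz| / (ε / 4) ≤ L := by
        linarith [le_max_left (5 * |β * hz| / (ε / 4) + 1) (max ((3 * κ + 6) / (ε / 4)) (2 / (1 - y) + 1))]
      rw [div_le_iff₀ hε4] at h1
      have hmul' : ε / 4 * (L : ℝ) ≤ ε / 4 * (L : ℝ) ^ 2 := mul_le_mul_of_nonneg_left hLsq hε4.le
      linarith
    · have h1 : (3 * κ + 6) / (ε / 4) ≤ L := (le_max_left _ _).trans ((le_max_right _ _).trans hL)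
      rw [div_le_iff₀ hε4] at h1
      have hL0' : (0 : ℝ) ≤ L := by linarith
      have : (3 * κ + 6) * (L : ℝ) ≤ (L * (ε / 4)) * L := mul_le_mul_of_nonneg_right h1 hL0'
      nlinarith
    · have h1 : 2 / (1 - y) ≤ L := by
        linarith [((le_max_right _ _).trans ((le_max_right _ _).trans hL) : 2 / (1 - y) + 1 ≤ (L : ℝ))]
      rw [div_le_iff₀ hy1'] at h1
      linarith
  filter_upwards [hE1, hE2, eventually_ge_atTop 1] with L hE1L ⟨hA, hB, hC⟩ hL1
  -- the sector numbers
  set a₀ := halfRectN (2 * x) L with ha₀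
  set b₀ := halfRectN (2 * y) L with hb₀
  set N := rectN n L with hNdef
  set a' := min a₀ N with ha'
  set b' := N - a' with hb'
  set M := L * L with hM
  have hL1r : (1 : ℝ) ≤ L := by exact_mod_cast hL1
  have hL2 : (0 : ℝ) < (L : ℝ) ^ 2 := by positivity
  have hMr : ((M : ℕ) : ℝ) = (L : ℝ) ^ 2 := by rw [hM]; push_cast; ring
  obtain ⟨ha₀X, hXa₀⟩ := halfRectN_two_mul_bounds hx0 L
  obtain ⟨hb₀Y, hYb₀⟩ := halfRectN_two_mul_bounds hy0 L
  rw [← ha₀] at ha₀X hXa₀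
  rw [← hb₀] at hb₀Y hYb₀
  have hNle : (N : ℝ) ≤ x * (L : ℝ) ^ 2 + y * (L : ℝ) ^ 2 := by
    have := rectN_le hn0.le L; rw [← hNdef] at this; rw [hy]; linarith
  have hNlt : x * (L : ℝ) ^ 2 + y * (L : ℝ) ^ 2 < N + 2 := by
    have := lt_rectN_add_two n L; rw [← hNdef] at this; rw [hy]; linarith
  obtain ⟨hda, hdb⟩ := rounding_aux ha₀X hXa₀ hb₀Y hYb₀ hNle hNlt
  rw [← hb'] at hdb
  -- ranges: `a₀, b₀, a', b' ≤ M`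
  have ha₀M : a₀ ≤ M := (halfRectN_lt_sq (by linarith) (by linarith) hL1).le
  have hb₀M : b₀ ≤ M := (halfRectN_lt_sq (by linarith) (by linarith) hL1).le
  have ha'M : a' ≤ M := (min_le_left _ _).trans ha₀M
  have hb'M : b' ≤ M := by
    have h1 : ((b' : ℕ) : ℝ) ≤ (L : ℝ) ^ 2 := by
      have : ((b' : ℕ) : ℝ) ≤ b₀ + 2 := by rw [abs_le] at hdb; linarith
      linarith
    rw [← hMr] at h1
    exact_mod_cast h1
  have ha'N : a' ≤ N := min_le_right _ _
  -- the chosen term is positive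
  have hHerm := hubbardRectTorusTT'_isHermitian L L t t' U
  haveI := nonempty_spinConfig (Λ := Fin L ×ₗ Fin L) (a := a') (b := b')
    (by rw [card_rectSites]; exact ha'M) (by rw [card_rectSites]; exact hb'M)
  have hZ' : 0 < (partitionFn β (spinSectorHamiltonian a' b' (hubbardRectTorusTT' L L t t' U))).re :=
    partitionFn_spinSector_re_pos hHerm β
  -- equicontinuity: `log Z(a',b') ≥ log Z(a₀,b₀) − 3κ − 3 log M`
  have hf := abs_interactionEntropy_sub_le_fst hβ.le t t' hU L (a := a₀) (a' := a') (b := b₀) ha₀M ha'M hb₀M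
  have hs := abs_interactionEntropy_sub_le_snd hβ.le t t' hU L (a := a') (b := b₀) (b' := b') ha'M hb₀M hb'M
  have hca := abs_log_choose_sub_le' (M := M) ha'M ha₀M
  have hcb := abs_log_choose_sub_le' (M := M) hb'M hb₀M
  have hlogM : Real.log ((M : ℕ) : ℝ) ≤ 2 * L := log_mul_self_le L
  have hlogM0 : 0 ≤ Real.log ((M : ℕ) : ℝ) := Real.log_nonneg (by rw [hMr]; nlinarith)
  rw [← hκ] at hf hs
  have hκa : κ * |(a' : ℝ) - a₀| ≤ κ * 1 := mul_le_mul_of_nonneg_left hda hκ0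
  have hκb : κ * |(b' : ℝ) - b₀| ≤ κ * 2 := mul_le_mul_of_nonneg_left hdb hκ0
  have hla : |(a' : ℝ) - a₀| * Real.log ((M : ℕ) : ℝ) ≤ 1 * Real.log ((M : ℕ) : ℝ) :=
    mul_le_mul_of_nonneg_right hda hlogM0
  have hlb : |(b' : ℝ) - b₀| * Real.log ((M : ℕ) : ℝ) ≤ 2 * Real.log ((M : ℕ) : ℝ) :=
    mul_le_mul_of_nonneg_right hdb hlogM0
  rw [abs_le] at hf hs hca hcb
  have hchain : Real.log (partitionFn β (spinSectorHamiltonian a₀ b₀ (hubbardRectTorusTT' L L t t' U))).re -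
      3 * κ - 3 * Real.log ((M : ℕ) : ℝ) ≤
      Real.log (partitionFn β (spinSectorHamiltonian a' b' (hubbardRectTorusTT' L L t t' U))).re := by
    linarith only [hf.1, hs.1, hca.1, hcb.1, hκa, hκb, hla, hlb]
  -- the term bound `log Z_N ≥ βh(a' − b') + log Z(a',b')`
  have hterm := term_le_torusPartitionSumTT'Zeeman β t t' U hz L N ha'N
  rw [← hb'] at hterm
  have hpos := torusPartitionSumTT'Zeeman_pos β t t' U hz hn0.le hn2.le L
  rw [← hNdef] at hpos
  have hlogZN : β * hz * ((a' : ℝ) - (b' : ℝ)) +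
      Real.log (partitionFn β (spinSectorHamiltonian a' b' (hubbardRectTorusTT' L L t t' U))).re ≤
      Real.log (torusPartitionSumTT'Zeeman β t t' U hz L N) := by
    have h := Real.log_le_log (mul_pos (Real.exp_pos _) hZ') hterm
    rwa [Real.log_mul (Real.exp_pos _).ne' hZ'.ne', Real.log_exp] at h
  -- the field term: `βh(a' − b') ≥ βh(x − y) L² − 5|βh|`
  have hfield : β * hz * (x - y) * (L : ℝ) ^ 2 - 5 * |β * hz| ≤ β * hz * ((a' : ℝ) - (b' : ℝ)) := by
    have e : β * hz * ((a' : ℝ) - (b' : ℝ)) = β * hz * (x - y) * (L : ℝ) ^ 2 +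
        β * hz * (((a' : ℝ) - a₀) + ((a₀ : ℝ) - x * (L : ℝ) ^ 2) - (((b' : ℝ) - b₀) + ((b₀ : ℝ) - y * (L : ℝ) ^ 2))) := by
      ring
    rw [e]
    have hD : |((a' : ℝ) - a₀) + ((a₀ : ℝ) - x * (L : ℝ) ^ 2) - (((b' : ℝ) - b₀) + ((b₀ : ℝ) - y * (L : ℝ) ^ 2))| ≤ 5 := by
      have hda' := abs_le.1 hda
      have hdb' := abs_le.1 hdb
      rw [abs_le]; constructor <;> linarith [hda'.1, hda'.2, hdb'.1, hdb'.2]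
    have h1 := neg_abs_le (β * hz * (((a' : ℝ) - a₀) + ((a₀ : ℝ) - x * (L : ℝ) ^ 2) -
      (((b' : ℝ) - b₀) + ((b₀ : ℝ) - y * (L : ℝ) ^ 2))))
    rw [abs_mul] at h1
    have h2 := mul_le_mul_of_nonneg_left hD (abs_nonneg (β * hz))
    linarith
  -- assemble, per volume
  have hsp : spinSectorPressureTT' β t t' U x y L * (L : ℝ) ^ 2 =
      Real.log (partitionFn β (spinSectorHamiltonian a₀ b₀ (hubbardRectTorusTT' L L t t' U))).re := by
    rw [spinSectorPressureTT', ← ha₀, ← hb₀, div_mul_cancel₀ _ hL2.ne']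
  unfold torusPressureTT'Zeeman
  rw [← hNdef, le_div_iff₀ hL2]
  have hxy : x - y = 2 * x - n := by rw [hy]; ring
  rw [hxy] at hfield
  have hE1' := mul_le_mul_of_nonneg_right hE1L hL2.le
  rw [sub_mul, hsp] at hE1'
  have hlogM3 : 3 * Real.log ((M : ℕ) : ℝ) ≤ 6 * L := by linarith
  have hκL : 3 * κ ≤ 3 * κ * L := le_mul_of_one_le_right (by positivity) hL1r
  have hdom' := mul_le_mul_of_nonneg_right hdom hL2.le
  have eB : (3 * κ + 6) * (L : ℝ) = 3 * κ * L + 6 * L := by ring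
  rw [eB] at hB
  have edom : (pressureTT'₂ β t t' U x y + β * hz * (2 * x - n)) * (L : ℝ) ^ 2 =
      pressureTT'₂ β t t' U x y * (L : ℝ) ^ 2 + β * hz * (2 * x - n) * (L : ℝ) ^ 2 := by ring
  rw [edom] at hdom'
  linarith only [hlogZN, hfield, hchain, hE1', hA, hB, hdom', hlogM3, hκL]

/-! ### §2 The limit -/

/-- **THE CANONICAL PRESSURE IN A ZEEMAN FIELD EXISTS AS A THERMODYNAMIC LIMIT AND IS THE NUMBER**
`pressureTT'Zeeman`: `L⁻² log Σ_{a} e^{βh(2a − N)} Re Z_β(hubbardRectTorusTT' L L t t' U; a, N − a) → p(β; t,t',U; n, h)`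
along `N = rectN n L` (`β > 0`, `U ≥ 0`, `0 < n < 2`, every real `h`). [cite: Ruelle1969, §3.4] -/
theorem tendsto_torusPressureTT'Zeeman :
    Tendsto (fun L : ℕ => torusPressureTT'Zeeman β t t' U n hz L) atTop (𝓝 (pressureTT'Zeeman β t t' U n hz)) := by
  rw [tendsto_order]
  constructor
  · intro q hq
    filter_upwards [eventually_le_torusPressureTT'Zeeman hβ t t' hU hn0 hn2 hz (ε := (pressureTT'Zeeman β t t' U n hz - q) / 2)
      (by linarith)] with L hL
    linarith
  · intro q hq
    filter_upwards [eventually_torusPressureTT'Zeeman_le hβ t t' hU hn0 hn2 hz (ε := (q - pressureTT'Zeeman β t t' U n hz) / 2)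
      (by linarith)] with L hL
    linarith

/-- The limit along any side sequence `Ls → ∞`. [cite: Ruelle1969, §3.4] -/
theorem tendsto_torusPressureTT'Zeeman_comp {Ls : ℕ → ℕ} (hLs : Tendsto Ls atTop atTop) :
    Tendsto (fun j : ℕ => torusPressureTT'Zeeman β t t' U n hz (Ls j)) atTop (𝓝 (pressureTT'Zeeman β t t' U n hz)) :=
  (tendsto_torusPressureTT'Zeeman hβ t t' hU hn0 hn2 hz).comp hLs

/-! ### §3 The certificate dictionary -/

/-- **Ceilings in a field are bounds on the number**: if along some `Ls → ∞`, for every `ε > 0` eventually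
`log Z_{rectN n L}^h(L) ≤ (q + ε) L²`, then `p(β; n, h) ≤ q`. [cite: Israel1979, Thm. I.2.4] -/
theorem pressureTT'Zeeman_le_of_eventually {Ls : ℕ → ℕ} (hLs : Tendsto Ls atTop atTop) {q : ℝ}
    (h : ∀ ε > 0, ∀ᶠ j : ℕ in atTop, Real.log (torusPartitionSumTT'Zeeman β t t' U hz (Ls j) (rectN n (Ls j))) ≤
      (q + ε) * ((Ls j : ℕ) : ℝ) ^ 2) :
    pressureTT'Zeeman β t t' U n hz ≤ q := by
  refine le_of_forall_pos_le_add fun ε hε => ?_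
  refine le_of_tendsto (tendsto_torusPressureTT'Zeeman_comp hβ t t' hU hn0 hn2 hz hLs) ?_
  filter_upwards [h ε hε, hLs.eventually_ge_atTop 1] with j hj hj1
  have hL2 : (0 : ℝ) < ((Ls j : ℕ) : ℝ) ^ 2 := by
    have : (1 : ℝ) ≤ (Ls j : ℕ) := by exact_mod_cast hj1
    positivity
  unfold torusPressureTT'Zeeman
  rwa [div_le_iff₀ hL2]

/-- **Floors in a field are bounds on the number**: if along some `Ls → ∞`, for every `ε > 0` eventually
`(W − ε) L² ≤ log Z_{rectN n L}^h(L)`, then `W ≤ p(β; n, h)`. [cite: Israel1979, Thm. I.2.4] -/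
theorem le_pressureTT'Zeeman_of_eventually {Ls : ℕ → ℕ} (hLs : Tendsto Ls atTop atTop) {W : ℝ}
    (h : ∀ ε > 0, ∀ᶠ j : ℕ in atTop, (W - ε) * ((Ls j : ℕ) : ℝ) ^ 2 ≤
      Real.log (torusPartitionSumTT'Zeeman β t t' U hz (Ls j) (rectN n (Ls j)))) :
    W ≤ pressureTT'Zeeman β t t' U n hz := by
  have key : ∀ ε > 0, W - ε ≤ pressureTT'Zeeman β t t' U n hz := by
    intro ε hε
    refine ge_of_tendsto (tendsto_torusPressureTT'Zeeman_comp hβ t t' hU hn0 hn2 hz hLs) ?_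
    filter_upwards [h ε hε, hLs.eventually_ge_atTop 1] with j hj hj1
    have hL2 : (0 : ℝ) < ((Ls j : ℕ) : ℝ) ^ 2 := by
      have : (1 : ℝ) ≤ (Ls j : ℕ) := by exact_mod_cast hj1
      positivity
    unfold torusPressureTT'Zeeman
    rwa [le_div_iff₀ hL2]
  exact le_of_forall_pos_le_add fun ε hε => by linarith [key ε hε]

/-- **A single trial sector is a floor**: one certified eventual per-volume floor on ONE (nonempty) spin sector of
filling `n`, `(W − ε) L² ≤ βh(2a_L − N_L) + log Re Z(a_L, N_L − a_L)`, bounds `p(n,h)` from below. [cite: Ruelle1969, §3.4] -/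
theorem le_pressureTT'Zeeman_of_eventually_sector {Ls : ℕ → ℕ} (hLs : Tendsto Ls atTop atTop) {W : ℝ}
    (a : ℕ → ℕ) (ha : ∀ j, a j ≤ rectN n (Ls j)) (haM : ∀ j, a j ≤ Ls j * Ls j)
    (hbM : ∀ j, rectN n (Ls j) - a j ≤ Ls j * Ls j)
    (h : ∀ ε > 0, ∀ᶠ j : ℕ in atTop, (W - ε) * ((Ls j : ℕ) : ℝ) ^ 2 ≤
      β * hz * ((a j : ℝ) - ((rectN n (Ls j) - a j : ℕ) : ℝ)) +
        Real.log (partitionFn β (spinSectorHamiltonian (a j) (rectN n (Ls j) - a j)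
          (hubbardRectTorusTT' (Ls j) (Ls j) t t' U))).re) :
    W ≤ pressureTT'Zeeman β t t' U n hz := by
  refine le_pressureTT'Zeeman_of_eventually hβ t t' hU hn0 hn2 hz hLs fun ε hε => ?_
  filter_upwards [h ε hε] with j hj
  refine hj.trans ?_
  haveI := nonempty_spinConfig (Λ := Fin (Ls j) ×ₗ Fin (Ls j)) (a := a j) (b := rectN n (Ls j) - a j)
    (by rw [card_rectSites]; exact haM j) (by rw [card_rectSites]; exact hbM j)
  have hZ : 0 < (partitionFn β (spinSectorHamiltonian (a j) (rectN n (Ls j) - a j)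
      (hubbardRectTorusTT' (Ls j) (Ls j) t t' U))).re :=
    partitionFn_spinSector_re_pos (hubbardRectTorusTT'_isHermitian _ _ t t' U) β
  have hterm := term_le_torusPartitionSumTT'Zeeman β t t' U hz (Ls j) (rectN n (Ls j)) (ha j)
  have hlog := Real.log_le_log (mul_pos (Real.exp_pos _) hZ) hterm
  rwa [Real.log_mul (Real.exp_pos _).ne' hZ.ne', Real.log_exp] at hlog

end Limit

end ThermodynamicLimit

end Literature.MathematicalPhysics.QuantumLattice
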